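import Summits.QuantumFields.YangMills.Theorems.SwapVirialDeficitBlowUpRingChart
import HarnessLib

/-!
# QUADRATIC GROWTH and SEPARATION of the chart deficit, window-uniform and hub-angle independent (from w2 g57's global ✓`chartBox_of_chartDeficit`)
# — the model-side inputs (M2)(a)-core ∕ (M5) ∕ §4(a)(c) of w2 g58's Morse–Bott road (memo w2-g58-memo-24197-fibred-laplace.md; line of record, LEAD g97)
# (free-hands support of ⟨stmt-QuantumFields-24197⟩ `SwapVirialDeficit.SwapGluedStiffness`)

w2 g57's box lemma is GLOBAL: for every chart point `q = (C, U) ∈ SU(2)⁴ × SU(2)^{Fol L}`, `‖C_μC_ν − C_νC_μ‖_F ≤ 60L³√F̂(q)`, `‖c·C_{σμ} − C_μ·c‖_F ≤ 60L³√F̂(q)`,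
`‖U_i − 1‖_F ≤ 48L³√F̂(q)` (`F̂ = chartDeficit L 0 1`, principal sector).  Squared and summed, this is exactly the window-uniform information the fibred Laplace assembly
asks for, with POLYNOMIAL, HUB-ANGLE-INDEPENDENT constants:

* §1 ★ `follower_frobNorm_sq_le_chartDeficit` (`‖U_i − 1‖²_F ≤ 2304·L⁶·F̂`), ★★ `sum_follower_frobNorm_sq_le_chartDeficit`
  (`Σ_i ‖U_i − 1‖²_F ≤ 2304·L⁶·|Fol L|·F̂`) = QUADRATIC GROWTH in the follower directions from the minimum value `0` at `U ≡ 1` — for EVERY leader tuple `C`,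
  flat or not; at flat `C` it is the `hgrowth` input of ✓`QuantitativeLaplace.inner_ge_of_growth_of_taylor` (w3 g65), i.e. the follower Hessian block at flat points
  is `≥ 2/(2304·L⁶·|Fol L|)` in Frobenius coordinates once the J-jets give the quartic Taylor datum — the «follower gap λ_F ≥ L^{−k}, ψ-independent» of §4(a);
* §2 ★ `comm_frobNorm_sq_le_chartDeficit`, `sigmaRel_frobNorm_sq_le_chartDeficit`, ★★ `relations_sq_sum_le_chartDeficit`
  (`Σ_{μ,ν}‖[C_μ,C_ν]‖²_F + Σ_μ‖cC_{σμ} − C_μc‖²_F ≤ 43200·L⁶·F̂`) — growth in the leader-relation energy `Φ(C)` (§4(c): `F̂ ≥ κ·Φ(C)·L^{−6}`, off-`N` separation);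
* §3 SEPARATION off tubes: ★ `chartDeficit_ge_of_follower_far` (`R ≤ ‖U_i − 1‖_F ⟹ R²/(2304L⁶) ≤ F̂`), ★ `chartDeficit_ge_of_comm_far`, ★ `chartDeficit_ge_of_sigmaRel_far`
  (`R²/(3600L⁶) ≤ F̂`) — the (M5) input: off the tube the Gibbs factor is `≤ e^{−bR²/(3600L⁶)}`, negligible on every window once combined with
  ✓`swap_laplace_floor_uniform` ∕ ✓`swap_deficit_gibbs_tail_le`.

HONEST LABEL: bookkeeping (squares of landed pointwise bounds); the Hessian-Lipschitz step for NEAR-flat leaders (J-jets, fcl-p3 g47) and (M4) are not here;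
⟨24197⟩ (window-uniform) ∕ ⟨24196⟩ ∕ ⟨24194⟩ ∕ ⟨24497⟩ OPEN; own crux ⟨22884⟩ OPEN (blocked-on ⟨19935⟩); no crux, rung of record or summit is proved; the Yang–Mills mass gap
is NOT proved; no summit is proved by a line.  THEOREMS ONLY (0 `def`, 0 `sorry`), standard axioms.  Width seat ym-line-sfw-p2-w3 g65 (cell ym-idea-1, free hands),
`--supports stmt-QuantumFields-24197`.  References: [cite: Luscher1983, §2]; [folklore].
-/

set_option autoImplicit false

noncomputable section

open MeasureTheory
open scoped BigOperators
open Literature.MathematicalPhysics.QuantumFieldTheory hiding SU2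
open Literature.MathematicalPhysics.QuantumLattice

namespace Summit.QuantumFields.YangMills.Theorems.SwapVirialDeficit.BlowUpRing

open Summit.QuantumFields.YangMills.Theorems.FemtoTransferGap
open Summit.QuantumFields.YangMills.Theorems.FemtoTransferGap.TT
open Summit.QuantumFields.YangMills.Theorems.VirialFluxGap.RingDeficit
open Summit.QuantumFields.YangMills.Theorems.SwapVirialDeficit.SwapRing

variable {L : ℕ} [NeZero L]

/-- Squaring a box bound: `0 ≤ a ≤ c·√F` with `0 ≤ F` gives `a² ≤ c²·F`. [folklore] -/
theorem sq_le_sq_mul_of_le_mul_sqrt {a c F : ℝ} (ha : 0 ≤ a) (hF : 0 ≤ F) (h : a ≤ c * Real.sqrt F) : a ^ 2 ≤ c ^ 2 * F := by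
  calc a ^ 2 ≤ (c * Real.sqrt F) ^ 2 := pow_le_pow_left₀ ha h 2
    _ = c ^ 2 * F := by rw [mul_pow, Real.sq_sqrt hF]

/-- The reverse direction: `R ≤ a`, `a ≤ c√F`, `0 ≤ R`, `0 < c` give `R²/c² ≤ F`. [folklore] -/
theorem div_sq_le_of_le_of_le_mul_sqrt {a c F R : ℝ} (hR : 0 ≤ R) (hc : 0 < c) (hF : 0 ≤ F) (hRa : R ≤ a) (h : a ≤ c * Real.sqrt F) :
    R ^ 2 / c ^ 2 ≤ F := by
  have h1 : R ^ 2 ≤ c ^ 2 * F := sq_le_sq_mul_of_le_mul_sqrt hR hF (hRa.trans h)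
  rw [div_le_iff₀ (by positivity)]
  linarith

/-! ## §1 Quadratic growth in the follower directions (every leader tuple) -/

/-- ★ **Per-follower growth**: `‖U_i − 1‖²_F ≤ 2304·L⁶·F̂(C,U)` for EVERY chart point (✓`chartBox_of_chartDeficit`, squared). [cite: Luscher1983, §2] -/
theorem follower_frobNorm_sq_le_chartDeficit (q : (Fin 4 → SU2) × (Fol L → SU2)) (i : Fol L) :
    frobNorm (((q.2 i : SU2) : Matrix (Fin 2) (Fin 2) ℂ) - 1) ^ 2 ≤ 2304 * (L : ℝ) ^ 6 * chartDeficit L (fun _ => false) (fun _ => 1) q := by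
  obtain ⟨-, -, hU⟩ := chartBox_of_chartDeficit (L := L) q
  have hF := chartDeficit_nonneg (fun _ => false) (fun _ => (1 : SU2)) q
  have h := sq_le_sq_mul_of_le_mul_sqrt (frobNorm_nonneg _) hF (hU i)
  calc _ ≤ (48 * (L : ℝ) ^ 3) ^ 2 * chartDeficit L (fun _ => false) (fun _ => 1) q := h
    _ = _ := by ring

/-- ★★ **GROWTH IN THE FOLLOWER DIRECTIONS, summed**: `Σ_i ‖U_i − 1‖²_F ≤ 2304·L⁶·|Fol L|·F̂(C,U)` for EVERY `(C, U)` — quadratic growth of the deficit away from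
`U ≡ 1` with the hub-angle-INDEPENDENT polynomial constant `μ_F(L) = (2304·L⁶·|Fol L|)⁻¹` (`|Fol L| = 6L⁴ − 3`).  At a flat leader tuple (`F̂(C,1) = 0`) this is the
`hgrowth` input of ✓`QuantitativeLaplace.inner_ge_of_growth_of_taylor` for the follower block. [cite: Luscher1983, §2] -/
theorem sum_follower_frobNorm_sq_le_chartDeficit (q : (Fin 4 → SU2) × (Fol L → SU2)) :
    ∑ i : Fol L, frobNorm (((q.2 i : SU2) : Matrix (Fin 2) (Fin 2) ℂ) - 1) ^ 2 ≤
      2304 * (L : ℝ) ^ 6 * (Fintype.card (Fol L) : ℝ) * chartDeficit L (fun _ => false) (fun _ => 1) q := by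
  calc ∑ i : Fol L, frobNorm (((q.2 i : SU2) : Matrix (Fin 2) (Fin 2) ℂ) - 1) ^ 2
      ≤ ∑ _i : Fol L, 2304 * (L : ℝ) ^ 6 * chartDeficit L (fun _ => false) (fun _ => 1) q :=
        Finset.sum_le_sum fun i _ => follower_frobNorm_sq_le_chartDeficit q i
    _ = _ := by rw [Finset.sum_const, Finset.card_univ, nsmul_eq_mul]; ring

/-- The growth constant written as a lower bound on the deficit: `(2304·L⁶·|Fol L|)⁻¹·Σ_i ‖U_i − 1‖²_F ≤ F̂(C,U)`. [cite: Luscher1983, §2] -/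
theorem chartDeficit_ge_sum_follower_frobNorm_sq (q : (Fin 4 → SU2) × (Fol L → SU2)) :
    (2304 * (L : ℝ) ^ 6 * (Fintype.card (Fol L) : ℝ))⁻¹ * ∑ i : Fol L, frobNorm (((q.2 i : SU2) : Matrix (Fin 2) (Fin 2) ℂ) - 1) ^ 2 ≤
      chartDeficit L (fun _ => false) (fun _ => 1) q := by
  have hL : (0 : ℝ) < L := by exact_mod_cast NeZero.pos L
  have hcard : 0 < Fintype.card (Fol L) := by rw [card_fol]; have := Nat.one_le_pow 4 L NeZero.one_le; omega
  have hK : (0 : ℝ) < 2304 * (L : ℝ) ^ 6 * (Fintype.card (Fol L) : ℝ) := by positivity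
  rw [inv_mul_le_iff₀ hK]
  exact sum_follower_frobNorm_sq_le_chartDeficit q

/-! ## §2 Growth in the leader relations (the relation energy `Φ(C)` against the deficit) -/

/-- ★ `‖C_μC_ν − C_νC_μ‖²_F ≤ 3600·L⁶·F̂(C,U)`. [cite: Luscher1983, §2] -/
theorem comm_frobNorm_sq_le_chartDeficit (q : (Fin 4 → SU2) × (Fol L → SU2)) (μ ν : Fin 3) :
    frobNorm (((q.1 (Fin.castSucc μ) * q.1 (Fin.castSucc ν) : SU2) : Matrix (Fin 2) (Fin 2) ℂ) -
        ((q.1 (Fin.castSucc ν) * q.1 (Fin.castSucc μ) : SU2) : Matrix (Fin 2) (Fin 2) ℂ)) ^ 2 ≤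
      3600 * (L : ℝ) ^ 6 * chartDeficit L (fun _ => false) (fun _ => 1) q := by
  obtain ⟨hC, -, -⟩ := chartBox_of_chartDeficit (L := L) q
  have hF := chartDeficit_nonneg (fun _ => false) (fun _ => (1 : SU2)) q
  have h := sq_le_sq_mul_of_le_mul_sqrt (frobNorm_nonneg _) hF (hC μ ν)
  calc _ ≤ (60 * (L : ℝ) ^ 3) ^ 2 * chartDeficit L (fun _ => false) (fun _ => 1) q := h
    _ = _ := by ring

/-- ★ `‖c·C_{σμ} − C_μ·c‖²_F ≤ 3600·L⁶·F̂(C,U)` (the σ-relations of the hub letter `c = C₃`). [cite: Luscher1983, §2] -/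
theorem sigmaRel_frobNorm_sq_le_chartDeficit (q : (Fin 4 → SU2) × (Fol L → SU2)) (μ : Fin 3) :
    frobNorm (((q.1 (Fin.last 3) * q.1 (Fin.castSucc (Equiv.swap (0 : Fin 3) 1 μ)) : SU2) : Matrix (Fin 2) (Fin 2) ℂ) -
        ((q.1 (Fin.castSucc μ) * q.1 (Fin.last 3) : SU2) : Matrix (Fin 2) (Fin 2) ℂ)) ^ 2 ≤
      3600 * (L : ℝ) ^ 6 * chartDeficit L (fun _ => false) (fun _ => 1) q := by
  obtain ⟨-, hσ, -⟩ := chartBox_of_chartDeficit (L := L) q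
  have hF := chartDeficit_nonneg (fun _ => false) (fun _ => (1 : SU2)) q
  have h := sq_le_sq_mul_of_le_mul_sqrt (frobNorm_nonneg _) hF (hσ μ)
  calc _ ≤ (60 * (L : ℝ) ^ 3) ^ 2 * chartDeficit L (fun _ => false) (fun _ => 1) q := h
    _ = _ := by ring

/-- ★★ **GROWTH IN THE RELATION ENERGY**: `Σ_{μ,ν} ‖[C_μ,C_ν]‖²_F + Σ_μ ‖cC_{σμ} − C_μc‖²_F ≤ 43200·L⁶·F̂(C,U)` (`9 + 3` relations) — i.e. `F̂ ≥ Φ(C)/(43200L⁶)` for the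
relation energy `Φ(C)` of the near-flat base `N = {Φ < ρ₀²}` of architecture v2 (§4(c): off-`N` separation with `κ = 1/43200`, `k = 6`). [cite: Luscher1983, §2] -/
theorem relations_sq_sum_le_chartDeficit (q : (Fin 4 → SU2) × (Fol L → SU2)) :
    (∑ μ : Fin 3, ∑ ν : Fin 3, frobNorm (((q.1 (Fin.castSucc μ) * q.1 (Fin.castSucc ν) : SU2) : Matrix (Fin 2) (Fin 2) ℂ) -
        ((q.1 (Fin.castSucc ν) * q.1 (Fin.castSucc μ) : SU2) : Matrix (Fin 2) (Fin 2) ℂ)) ^ 2) +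
      ∑ μ : Fin 3, frobNorm (((q.1 (Fin.last 3) * q.1 (Fin.castSucc (Equiv.swap (0 : Fin 3) 1 μ)) : SU2) : Matrix (Fin 2) (Fin 2) ℂ) -
        ((q.1 (Fin.castSucc μ) * q.1 (Fin.last 3) : SU2) : Matrix (Fin 2) (Fin 2) ℂ)) ^ 2 ≤
      43200 * (L : ℝ) ^ 6 * chartDeficit L (fun _ => false) (fun _ => 1) q := by
  have h1 : ∑ μ : Fin 3, ∑ ν : Fin 3, frobNorm (((q.1 (Fin.castSucc μ) * q.1 (Fin.castSucc ν) : SU2) : Matrix (Fin 2) (Fin 2) ℂ) -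
        ((q.1 (Fin.castSucc ν) * q.1 (Fin.castSucc μ) : SU2) : Matrix (Fin 2) (Fin 2) ℂ)) ^ 2 ≤
      ∑ _μ : Fin 3, ∑ _ν : Fin 3, 3600 * (L : ℝ) ^ 6 * chartDeficit L (fun _ => false) (fun _ => 1) q :=
    Finset.sum_le_sum fun μ _ => Finset.sum_le_sum fun ν _ => comm_frobNorm_sq_le_chartDeficit q μ ν
  have h2 : ∑ μ : Fin 3, frobNorm (((q.1 (Fin.last 3) * q.1 (Fin.castSucc (Equiv.swap (0 : Fin 3) 1 μ)) : SU2) : Matrix (Fin 2) (Fin 2) ℂ) -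
        ((q.1 (Fin.castSucc μ) * q.1 (Fin.last 3) : SU2) : Matrix (Fin 2) (Fin 2) ℂ)) ^ 2 ≤
      ∑ _μ : Fin 3, 3600 * (L : ℝ) ^ 6 * chartDeficit L (fun _ => false) (fun _ => 1) q :=
    Finset.sum_le_sum fun μ _ => sigmaRel_frobNorm_sq_le_chartDeficit q μ
  simp only [Finset.sum_const, Finset.card_univ, Fintype.card_fin, nsmul_eq_mul, Nat.cast_ofNat] at h1 h2
  linarith

/-! ## §3 Separation off tubes -/

/-- ★ **Separation in a follower direction**: if some follower is `R`-far from `1` in Frobenius norm (`0 ≤ R ≤ ‖U_i − 1‖_F`), then `R²/(2304·L⁶) ≤ F̂(C,U)` — off the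
follower tube of radius `R` the Gibbs factor is `≤ exp(−b·R²/(2304L⁶))`, the (M5) input. [cite: Luscher1983, §2] -/
theorem chartDeficit_ge_of_follower_far (q : (Fin 4 → SU2) × (Fol L → SU2)) (i : Fol L) {R : ℝ} (hR : 0 ≤ R)
    (hfar : R ≤ frobNorm (((q.2 i : SU2) : Matrix (Fin 2) (Fin 2) ℂ) - 1)) :
    R ^ 2 / (2304 * (L : ℝ) ^ 6) ≤ chartDeficit L (fun _ => false) (fun _ => 1) q := by
  obtain ⟨-, -, hU⟩ := chartBox_of_chartDeficit (L := L) q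
  have hL : (0 : ℝ) < L := by exact_mod_cast NeZero.pos L
  have h := div_sq_le_of_le_of_le_mul_sqrt hR (by positivity : (0 : ℝ) < 48 * (L : ℝ) ^ 3)
    (chartDeficit_nonneg (fun _ => false) (fun _ => (1 : SU2)) q) hfar (hU i)
  calc R ^ 2 / (2304 * (L : ℝ) ^ 6) = R ^ 2 / (48 * (L : ℝ) ^ 3) ^ 2 := by ring
    _ ≤ _ := h

/-- ★ **Separation in a commutator**: `0 ≤ R ≤ ‖[C_μ, C_ν]‖_F ⟹ R²/(3600·L⁶) ≤ F̂(C,U)`. [cite: Luscher1983, §2] -/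
theorem chartDeficit_ge_of_comm_far (q : (Fin 4 → SU2) × (Fol L → SU2)) (μ ν : Fin 3) {R : ℝ} (hR : 0 ≤ R)
    (hfar : R ≤ frobNorm (((q.1 (Fin.castSucc μ) * q.1 (Fin.castSucc ν) : SU2) : Matrix (Fin 2) (Fin 2) ℂ) -
        ((q.1 (Fin.castSucc ν) * q.1 (Fin.castSucc μ) : SU2) : Matrix (Fin 2) (Fin 2) ℂ))) :
    R ^ 2 / (3600 * (L : ℝ) ^ 6) ≤ chartDeficit L (fun _ => false) (fun _ => 1) q := by
  obtain ⟨hC, -, -⟩ := chartBox_of_chartDeficit (L := L) q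
  have hL : (0 : ℝ) < L := by exact_mod_cast NeZero.pos L
  have h := div_sq_le_of_le_of_le_mul_sqrt hR (by positivity : (0 : ℝ) < 60 * (L : ℝ) ^ 3)
    (chartDeficit_nonneg (fun _ => false) (fun _ => (1 : SU2)) q) hfar (hC μ ν)
  calc R ^ 2 / (3600 * (L : ℝ) ^ 6) = R ^ 2 / (60 * (L : ℝ) ^ 3) ^ 2 := by ring
    _ ≤ _ := h

/-- ★ **Separation in a σ-relation**: `0 ≤ R ≤ ‖c·C_{σμ} − C_μ·c‖_F ⟹ R²/(3600·L⁶) ≤ F̂(C,U)`. [cite: Luscher1983, §2] -/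
theorem chartDeficit_ge_of_sigmaRel_far (q : (Fin 4 → SU2) × (Fol L → SU2)) (μ : Fin 3) {R : ℝ} (hR : 0 ≤ R)
    (hfar : R ≤ frobNorm (((q.1 (Fin.last 3) * q.1 (Fin.castSucc (Equiv.swap (0 : Fin 3) 1 μ)) : SU2) : Matrix (Fin 2) (Fin 2) ℂ) -
        ((q.1 (Fin.castSucc μ) * q.1 (Fin.last 3) : SU2) : Matrix (Fin 2) (Fin 2) ℂ))) :
    R ^ 2 / (3600 * (L : ℝ) ^ 6) ≤ chartDeficit L (fun _ => false) (fun _ => 1) q := by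
  obtain ⟨-, hσ, -⟩ := chartBox_of_chartDeficit (L := L) q
  have hL : (0 : ℝ) < L := by exact_mod_cast NeZero.pos L
  have h := div_sq_le_of_le_of_le_mul_sqrt hR (by positivity : (0 : ℝ) < 60 * (L : ℝ) ^ 3)
    (chartDeficit_nonneg (fun _ => false) (fun _ => (1 : SU2)) q) hfar (hσ μ)
  calc R ^ 2 / (3600 * (L : ℝ) ^ 6) = R ^ 2 / (60 * (L : ℝ) ^ 3) ^ 2 := by ring
    _ ≤ _ := h

end Summit.QuantumFields.YangMills.Theorems.SwapVirialDeficit.BlowUpRing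

end
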